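import Literature.Barriers.ValiantsHypothesis.CT23LowerBoundsFromSuccinctHittingSets
import HarnessLib

/-!
# Substitution into the FREE variables of a circuit with projection gates
# (Chatterjee–Tengse arXiv:2309.07612v2, the composition step of Prop. 2.28 / Claim 38's
# `P₁(x,u,w,v,z) := C_A(x, (1−z)u + zw, (1−z)w + zv)`; val-lit t18 g7, X-CT23 engine brick E-a)

Theorem-only (plus plumbing `def`s) companion of
`Literature/Barriers/ValiantsHypothesis/CT23LowerBoundsFromSuccinctHittingSets.lean`; NO named
facts. Honest framing: bookkeeping infrastructure for the source's `VPSPACE` constructions; it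
discharges nothing by itself; `VP ≠ VNP` is NOT proved and nothing here bears on it.

## What and why

The source's determinant-of-an-explicit-matrix construction (v2 Prop. 2.28 = v1 Prop. 36, Claim 38;
held text `paper:arxiv-2309.07612` p0013.txt:L9–L25) squares an explicitly encoded matrix with ONE
copy of its encoder per level: "`P₁(x,u,w,v,z) := C_A(x, ((1−z)u + zw), ((1−z)w + zv))`,
`D₁(x,u,v) := Σ_{w_1} ⋯ Σ_{w_L} ( proj_{z=0} P₁ · proj_{z=1} P₁ )` … As each of the `P_{i+1}`s and
`D_{i+1}`s have circuits (with projection gates) of size `O(log N)` with exactly one use of `D_i`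
and `P_{i+1}` respectively, all these increases are additive." The step `C_A ↦ P₁` SUBSTITUTES
polynomials for the FREE variables `u, v` of a circuit with projection gates. In the tree's model
(`ProjCircuit`: one global variable type, projection gates `proj i b u` substitute the Boolean
constant `b` for the variable `i` in the value of the operand `u`) such a substitution is sound
exactly when the substituted variables are never projected inside the circuit and the
substituting polynomials avoid the variables the circuit projects (its BOUND variables) — the
side condition `SubstCompat` below, discharged from these two syntactic facts by
`aeval_projVar_comm`. Everything mirrors the tree's `ArithCircuit.substCircuit`
(`ConstantFreeCircuits.lean`, Bürgisser 2000 Rem. 2.7) with one more gate kind.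

## Main declarations (namespace `Literature.Barriers.ValiantsHypothesis.ProjCircuit`)

* `Gate.subst e ρ n`, `subst P pre e ρ`: prefix gates `pre` (over the target variables `τ`)
  computing the polynomials to be substituted, a relabelling `e : σ → τ` of PROJECTED variables,
  operands `ρ : σ → Operand k τ` replacing the inputs `X i` and reading the prefix.
* `size_subst` (`= pre.length + P.size`), `isFanInTwo_subst`, `hasSignConstants_subst`.
* `aeval_projVar_comm`: `aeval h (proj_{i=c} v) = proj_{e i = c} (aeval h v)` from
  (C1) `h i = X (e i)` and (C2) `proj_{e i=c} (h i') = h i'` for `i' ≠ i`.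
* `eval_subst`: **`(P.subst pre e ρ).eval = aeval h P.eval`** when `ρ i` reads `h i` off the prefix
  values and `(h, e)` commute with the projections of the variables `P` projects (`SubstCompat`).

## References

* [ChatterjeeTengse2023] P. Chatterjee, A. Tengse, *Lower Bounds from Succinct Hitting Sets*,
  arXiv:2309.07612v2, Prop. 2.28 / Claim 38 (v1: Prop. 36, p0013.txt:L9–L25), Def. 2.19–2.20
  (v1: Def. 27–28).
* [Burgisser2000] P. Bürgisser, *Completeness and Reduction in Algebraic Complexity Theory*,
  Springer 2000, Rem. 2.7 (substitution), for the `ArithCircuit` half reused here.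
-/

noncomputable section

open MvPolynomial

namespace Literature.Barriers.ValiantsHypothesis

open Literature.Computability.AlgebraicComplexity

universe u v w

variable {k : Type u} [CommSemiring k] {σ : Type v} {τ : Type w}

/-! ### Projections commute with substitutions that respect the projected variable -/

section Commute

variable [DecidableEq σ] [DecidableEq τ]

/-- **The bound-variable side condition, discharged.** If the substitution `h` sends the variable
`i` to the variable `e i` (C1) and every other substituted polynomial `h i'` is untouched by
projecting `e i` (C2: it does not involve `e i`), then substituting after projecting `i` is
projecting `e i` after substituting. [cite: ChatterjeeTengse2023, Def. 2.19 and Claim 38 (v1: Def. 27; p0013.txt:L9–L25)] -/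
theorem aeval_projVar_comm {h : σ → MvPolynomial τ k} {e : σ → τ} {i : σ} (c : k)
    (h1 : h i = X (e i)) (h2 : ∀ i', i' ≠ i → projVar (e i) c (h i') = h i')
    (v : MvPolynomial σ k) :
    aeval h (projVar i c v) = projVar (e i) c (aeval h v) := by
  have key : (aeval h).comp (aeval fun j : σ => if j = i then C c else (X j : MvPolynomial σ k)) =
      (aeval fun j : τ => if j = e i then C c else (X j : MvPolynomial τ k)).comp (aeval h) := by
    refine MvPolynomial.algHom_ext fun j => ?_
    by_cases hj : j = i
    · subst hj
      simp [h1]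
    · rw [AlgHom.comp_apply, AlgHom.comp_apply, aeval_X, if_neg hj, aeval_X]
      exact (h2 j hj).symm
  exact DFunLike.congr_fun key v

/-- (C2) holds for a substituted polynomial that does not mention the projected variable.
[cite: ChatterjeeTengse2023, Def. 2.19 (v1: Def. 27)] -/
theorem projVar_eq_self_of_notMem_vars {j : τ} (c : k) {p : MvPolynomial τ k} (hj : j ∉ p.vars) :
    projVar j c p = p := by
  have hg : ∀ i ∈ p.vars, (fun i => if i = j then C c else (X i : MvPolynomial τ k)) i = X i := by
    intro i hi
    have hij : i ≠ j := fun h => hj (h ▸ hi)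
    simp [hij]
  unfold projVar
  conv_rhs => rw [← MvPolynomial.aeval_X_left_apply p]
  simp only [MvPolynomial.aeval_def]
  exact MvPolynomial.eval₂Hom_congr' rfl (fun i hi _ => hg i hi) rfl

end Commute

namespace ProjCircuit

/-! ### The substitution circuit -/

section Defs

/-- Substitution on one gate: arithmetic gates as `ArithCircuit.Gate.subst` (inputs `X i ↦ ρ i`,
gate references shifted past the prefix of length `n`); a projection gate keeps its Boolean
constant, relabels its variable by `e` and substitutes its operand.
[cite: ChatterjeeTengse2023, Def. 2.19–2.20 and Claim 38 (v1: Def. 27–28; p0013.txt:L9–L25)] -/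
def Gate.subst (e : σ → τ) (ρ : σ → ArithCircuit.Operand k τ) (n : ℕ) : Gate k σ → Gate k τ
  | .arith g => .arith (g.subst ρ n)
  | .proj i b u => .proj (e i) b (u.subst ρ n)

/-- **Substitution circuit**: the prefix gates `pre` followed by the gates of `P` with inputs
replaced by `ρ` and projected variables relabelled by `e`; output = the substituted output operand.
[cite: ChatterjeeTengse2023, Claim 38 "`P₁ := C_A(x, (1−z)u + zw, (1−z)w + zv)`" (v1: p0013.txt:L9–L25)] -/
def subst (P : ProjCircuit k σ) (pre : List (Gate k τ)) (e : σ → τ)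
    (ρ : σ → ArithCircuit.Operand k τ) : ProjCircuit k τ where
  gates := pre ++ P.gates.map (Gate.subst e ρ pre.length)
  output := P.output.subst ρ pre.length

omit [CommSemiring k] in
/-- Size of the substitution circuit: prefix plus `|P|` ("exactly one use of `D_i` … all these
increases are additive"). [cite: ChatterjeeTengse2023, Claim 38 (v1: p0013.txt:L22–L25)] -/
@[simp] theorem size_subst (P : ProjCircuit k σ) (pre : List (Gate k τ)) (e : σ → τ)
    (ρ : σ → ArithCircuit.Operand k τ) : (P.subst pre e ρ).size = pre.length + P.size := by
  simp [subst, size]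

omit [CommSemiring k] in
/-- Substitution does not change fan-in. [cite: ChatterjeeTengse2023, Def. 2.19 (v1: Def. 27)] -/
theorem Gate.fanIn_subst (e : σ → τ) (ρ : σ → ArithCircuit.Operand k τ) (n : ℕ) (g : Gate k σ) :
    (g.subst e ρ n).fanIn = g.fanIn := by
  cases g with
  | arith g => simp [Gate.subst, Gate.fanIn, ArithCircuit.Gate.fanIn_subst]
  | proj i b u => simp [Gate.subst, Gate.fanIn]

omit [CommSemiring k] in
/-- Fan-in two is kept if the prefix has fan-in two. [cite: ChatterjeeTengse2023, Def. 2.19 (v1: Def. 27)] -/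
theorem isFanInTwo_subst {P : ProjCircuit k σ} (hP : P.IsFanInTwo) {pre : List (Gate k τ)}
    (hpre : ∀ g ∈ pre, g.fanIn ≤ 2) (e : σ → τ) (ρ : σ → ArithCircuit.Operand k τ) :
    (P.subst pre e ρ).IsFanInTwo := by
  intro g hg
  simp only [subst, List.mem_append, List.mem_map] at hg
  rcases hg with hg | ⟨g', hg', rfl⟩
  · exact hpre g hg
  · rw [Gate.fanIn_subst]; exact hP g' hg'

/-- Sign constants are kept if the prefix gates and the substituting operands have them.
[cite: ChatterjeeTengse2023, Def. 2.20 (v1: Def. 28)] -/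
theorem hasSignConstants_subst {P : ProjCircuit k σ} (hP : P.HasSignConstants)
    {pre : List (Gate k τ)} (hpre : ∀ g ∈ pre, g.HasSignConstants) (e : σ → τ)
    {ρ : σ → ArithCircuit.Operand k τ} (hρ : ∀ i, (ρ i).HasSignConstants) :
    (P.subst pre e ρ).HasSignConstants := by
  refine ⟨fun g hg => ?_, hP.2.subst hρ _⟩
  simp only [subst, List.mem_append, List.mem_map] at hg
  rcases hg with hg | ⟨g', hg', rfl⟩
  · exact hpre g hg
  · cases g' with
    | arith g => exact ArithCircuit.Gate.HasSignConstants.subst hρ _ (hP.1 _ hg')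
    | proj i b u => exact ArithCircuit.Operand.HasSignConstants.subst hρ _ (hP.1 _ hg')

end Defs

/-! ### Semantics -/

section Semantics

variable [DecidableEq σ] [DecidableEq τ]

/-- The variables a circuit PROJECTS (its bound variables, in the source's reading).
[cite: ChatterjeeTengse2023, Def. 2.19 and Def. 2.23 (v1: Def. 27, 30)] -/
def projVars (P : ProjCircuit k σ) : Set σ :=
  {i | ∃ b u, Gate.proj i b u ∈ P.gates}

/-- **Compatibility of a substitution with the projections of `P`**: substituting after
projecting a variable that `P` projects is projecting its relabelling after substituting. Use
`aeval_projVar_comm` to discharge it from (C1)/(C2).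
[cite: ChatterjeeTengse2023, Claim 38 (v1: p0013.txt:L9–L25)] -/
def SubstCompat (P : ProjCircuit k σ) (e : σ → τ) (h : σ → MvPolynomial τ k) : Prop :=
  ∀ i ∈ P.projVars, ∀ (c : k) (v : MvPolynomial σ k),
    aeval h (projVar i c v) = projVar (e i) c (aeval h v)

omit [CommSemiring k] [DecidableEq σ] [DecidableEq τ] in
/-- A circuit with fewer gates projects fewer variables. [cite: ChatterjeeTengse2023, Def. 2.19 (v1: Def. 27)] -/
theorem projVars_mono {P Q : ProjCircuit k σ} (h : ∀ g ∈ P.gates, g ∈ Q.gates) :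
    P.projVars ⊆ Q.projVars := fun _ ⟨b, u, hg⟩ => ⟨b, u, h _ hg⟩

/-- Semantics of a substituted gate against `pre ++ (aeval h) vals`.
[cite: ChatterjeeTengse2023, Claim 38 (v1: p0013.txt:L9–L25)] -/
theorem Gate.eval_subst {e : σ → τ} {ρ : σ → ArithCircuit.Operand k τ}
    {pre : List (MvPolynomial τ k)} {h : σ → MvPolynomial τ k}
    (hρ : ∀ i ws, (ρ i).eval (pre ++ ws) = h i) (g : Gate k σ)
    (hg : ∀ i b u, g = Gate.proj i b u → ∀ (c : k) (v : MvPolynomial σ k),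
      aeval h (projVar i c v) = projVar (e i) c (aeval h v))
    (vals : List (MvPolynomial σ k)) :
    (g.subst e ρ pre.length).eval (pre ++ vals.map (aeval h)) = aeval h (g.eval vals) := by
  cases g with
  | arith g => exact ArithCircuit.Gate.eval_subst hρ g vals
  | proj i b u =>
    simp only [Gate.subst, Gate.eval]
    rw [ArithCircuit.Operand.eval_subst hρ u vals, hg i b u rfl]

/-- The fold over substituted gates, started on the prefix values.
[cite: ChatterjeeTengse2023, Claim 38 (v1: p0013.txt:L9–L25)] -/
theorem foldl_subst {e : σ → τ} {ρ : σ → ArithCircuit.Operand k τ}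
    {pre : List (MvPolynomial τ k)} {h : σ → MvPolynomial τ k}
    (hρ : ∀ i ws, (ρ i).eval (pre ++ ws) = h i) (gs : List (Gate k σ))
    (hgs : ∀ g ∈ gs, ∀ i b u, g = Gate.proj i b u → ∀ (c : k) (v : MvPolynomial σ k),
      aeval h (projVar i c v) = projVar (e i) c (aeval h v))
    (vals : List (MvPolynomial σ k)) :
    (gs.map (Gate.subst e ρ pre.length)).foldl (fun vs g => vs ++ [g.eval vs])
        (pre ++ vals.map (aeval h)) =
      pre ++ (gs.foldl (fun vs g => vs ++ [g.eval vs]) vals).map (aeval h) := by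
  induction gs generalizing vals with
  | nil => simp
  | cons g rest ih =>
    simp only [List.map_cons, List.foldl_cons]
    rw [Gate.eval_subst hρ g (hgs g (by simp)) vals, List.append_assoc,
      show vals.map (aeval h) ++ [aeval h (g.eval vals)] = (vals ++ [g.eval vals]).map (aeval h) by
        simp, ih (fun g' hg' => hgs g' (by simp [hg']))]

/-- **Semantics of the substitution circuit**: if `ρ i` reads `h i` off the values of the prefix
and `(h, e)` is compatible with the projections of `P`, then `P.subst pre e ρ` computes
`P.eval (h_1, …)`, i.e. `aeval h P.eval` — the content of "`P₁ := C_A(x, (1−z)u + zw, (1−z)w + zv)`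
… has a circuit with exactly one use of" `C_A`.
[cite: ChatterjeeTengse2023, Claim 38 (v1: p0013.txt:L9–L25)] -/
theorem eval_subst (P : ProjCircuit k σ) (pre : List (Gate k τ)) {e : σ → τ}
    {ρ : σ → ArithCircuit.Operand k τ} {h : σ → MvPolynomial τ k}
    (hρ : ∀ i ws, (ρ i).eval (gateValues pre ++ ws) = h i) (hcompat : P.SubstCompat e h) :
    (P.subst pre e ρ).eval = aeval h P.eval := by
  have hlen : pre.length = (gateValues pre).length := (gateValues_length (k := k) pre).symm
  have hgs : ∀ g ∈ P.gates, ∀ i b u, g = Gate.proj i b u → ∀ (c : k) (v : MvPolynomial σ k),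
      aeval h (projVar i c v) = projVar (e i) c (aeval h v) := by
    rintro g hg i b u rfl c v
    exact hcompat i ⟨b, u, hg⟩ c v
  change (P.output.subst ρ pre.length).eval
      (gateValues (pre ++ P.gates.map (Gate.subst e ρ pre.length))) = _
  have hgv : gateValues (pre ++ P.gates.map (Gate.subst e ρ pre.length)) =
      gateValues pre ++ (gateValues P.gates).map (aeval h) := by
    unfold gateValues
    rw [List.foldl_append, hlen]
    have := foldl_subst (k := k) hρ P.gates hgs []
    simpa [gateValues] using this
  rw [hgv, hlen, ArithCircuit.Operand.eval_subst hρ]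
  rfl

/-- `SubstCompat` from the two syntactic facts (C1) `h i = X (e i)` and (C2) "no other
substituted polynomial involves `e i`", for every variable `P` projects.
[cite: ChatterjeeTengse2023, Claim 38 (v1: p0013.txt:L9–L25)] -/
theorem substCompat_of_vars (P : ProjCircuit k σ) {e : σ → τ} {h : σ → MvPolynomial τ k}
    (h1 : ∀ i ∈ P.projVars, h i = X (e i))
    (h2 : ∀ i ∈ P.projVars, ∀ i', i' ≠ i → e i ∉ (h i').vars) : P.SubstCompat e h :=
  fun i hi c v => aeval_projVar_comm c (h1 i hi)
    (fun i' hi' => projVar_eq_self_of_notMem_vars c (h2 i hi i' hi')) v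

end Semantics

end ProjCircuit

end Literature.Barriers.ValiantsHypothesis
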